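import Summits.QuantumFields.YangMills.Theorems.IR.Negative.FixedMesh.ClauseI
import Summits.QuantumFields.YangMills.Theorems.IR.Negative.FixedMesh.Loop

/-!
# Fixed-mesh negative for format T, part 4/6: row-region geometry, properness, torus DLR, the pointwise bound, S1 `twistedTypicalPairs`

Part of the fixed-mesh negative for format T of crux `IR` (stmt-QuantumFields-19354, registered cut `af-pincer-T`
sha16 0308f95ca6f6a115); headline module `Theorems/IR/Negative/TypShellCondFalseFixedMesh.lean` (statement, provenance,
reading).  Content re-homed verbatim from the crux workfile `Cruxes/IR/CruxIdea8FixedMesh.lean` (cruxidea-8 GEN 5,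
tree sha16 d880b42bb52976de) under the namespace `Summit.QuantumFields.YangMills.Cruxes.IR.FixedMesh`; sorry-free.
-/

set_option autoImplicit false

noncomputable section

open MeasureTheory Filter Topology
open Literature.MathematicalPhysics.QuantumLattice
open Literature.Probability.LatticeModels
open Summit.QuantumFields.YangMills.Cruxes.IR.Tempered (cellEdges windowCells regionEdges)
open Summit.QuantumFields.YangMills.Cruxes.IR.ShellTempered (windowCellsPlus)
open Summit.QuantumFields.YangMills.Cruxes.IR.OnsetFormats (TypShellCond shellCount OnsetMixingTypical)

namespace Summit.QuantumFields.YangMills.Cruxes.IR.FixedMesh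

section FixedMesh

open Literature.MathematicalPhysics.QuantumFieldTheory (wilsonMeasure GaugeConfig isProbabilityMeasure_wilsonMeasure
  measurable_torusLift gaugeTransform wilsonMeasure_map_gaugeTransform_holds wilsonAction)

variable {G : Type} [Group G] [TopologicalSpace G] [IsTopologicalGroup G] [CompactSpace G]
  [SecondCountableTopology G] [MeasurableSpace G] [BorelSpace G]
  {N : ℕ} (ρ : G →* Matrix (Fin N) (Fin N) ℂ)


/-! ### 4c. Geometry of the row region: the staple is frozen, everything sits in the box (PROVED) -/

omit [TopologicalSpace G] [IsTopologicalGroup G] [CompactSpace G] [SecondCountableTopology G]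
  [MeasurableSpace G] [BorelSpace G] in
/-- Coordinates of an edge of the row region: time coordinate in `[1, b]`, every coordinate in
`[-(2n+1)b, (2n+1)b - 1]` (time: `≤ b`). -/
theorem coords_of_mem_rowRegion {b n : ℕ} {e : ZdEdge 4} (he : e ∈ rowRegion b n) :
    (1 ≤ e.1 0 ∧ e.1 0 ≤ (b : ℤ)) ∧
      ∀ i, -((2 * (n : ℤ) + 1) * b) ≤ e.1 i ∧ e.1 i + 1 ≤ (2 * (n : ℤ) + 1) * b + (if i = 0 then 1 else 0) := by
  unfold rowRegion regionEdges at he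
  obtain ⟨y, hy, hey⟩ := Finset.mem_biUnion.1 he
  have hy0 : y 0 = 0 := (Finset.mem_filter.1 hy).2
  have hyw : y ∈ windowCells n := (Finset.mem_filter.1 hy).1
  have hyi : ∀ i, -(2 * (n : ℤ)) ≤ y i ∧ y i ≤ 2 * (n : ℤ) := fun i => by
    have := Fintype.mem_piFinset.1 hyw i
    simpa [Finset.mem_Icc] using this
  have hei : ∀ i, stdFrame b i (y i) ≤ e.1 i ∧ e.1 i < stdFrame b i (y i + 1) := fun i =>
    Finset.mem_Ico.1 (Fintype.mem_piFinset.1 (Finset.mem_product.1 hey).1 i)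
  have hb : (0 : ℤ) ≤ b := Int.natCast_nonneg b
  have hn : (0 : ℤ) ≤ n := Int.natCast_nonneg n
  refine ⟨?_, fun i => ?_⟩
  · have h0 := hei 0
    simp only [stdFrame, if_true, hy0] at h0
    constructor <;> linarith
  · have h := hei i
    have h1 := mul_le_mul_of_nonneg_left (hyi i).1 hb
    have h2 := mul_le_mul_of_nonneg_left (hyi i).2 hb
    by_cases hi : i = 0
    · subst hi
      simp only [stdFrame, if_true, hy0] at h
      simp only [if_true]
      constructor <;> nlinarith
    · simp only [stdFrame, if_neg hi] at h
      simp only [if_neg hi]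
      constructor <;> nlinarith

omit [TopologicalSpace G] [IsTopologicalGroup G] [CompactSpace G] [SecondCountableTopology G]
  [MeasurableSpace G] [BorelSpace G] in
/-- **PROVED.** With `m = (2n+1)b` no staple edge is resampled by the row kernel. -/
theorem stapleEdges_disjoint_rowRegion {b n m : ℕ} (hm : (m : ℤ) = (2 * (n : ℤ) + 1) * b) :
    ∀ e ∈ stapleEdges b m, e ∉ rowRegion b n := by
  intro e he hrow
  have hc := coords_of_mem_rowRegion hrow
  simp only [stapleEdges, Finset.mem_union, Finset.mem_image, Finset.mem_range, Finset.mem_singleton] at he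
  rcases he with ((⟨s, _, rfl⟩ | ⟨t, _, rfl⟩) | ⟨s, _, rfl⟩) | rfl
  · have h := hc.1.2
    simp only [site2_zero] at h
    omega
  · have h := (hc.2 1).2
    simp only [site2_one, (show (1 : Fin 4) ≠ 0 by decide), if_false, add_zero] at h
    -- `h : ↑m + 1 ≤ (2n+1) b`
    linarith
  · have h := hc.1.1
    simp only [site2_zero] at h
    omega
  · have h := hc.1.1
    simp only [site2_zero] at h
    omega

omit [TopologicalSpace G] [IsTopologicalGroup G] [CompactSpace G] [SecondCountableTopology G]
  [MeasurableSpace G] [BorelSpace G] in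
/-- **PROVED.** The staple reads only frozen links: it is the same for every configuration gluing `ζ` off the row. -/
theorem staple_eq_of_eq_off_row {b n m : ℕ} (hm : (m : ℤ) = (2 * (n : ℤ) + 1) * b) {U ζ : LGConfig 4 G}
    (h : ∀ e, e ∉ rowRegion b n → U e = ζ e) : staple b m U = staple b m ζ :=
  staple_congr fun e he => h e (stapleEdges_disjoint_rowRegion hm e he)

omit [TopologicalSpace G] [IsTopologicalGroup G] [CompactSpace G] [SecondCountableTopology G]
  [MeasurableSpace G] [BorelSpace G] in
/-- **PROVED.** The row region with its plaquette collar is based in `box 4 S`, `S = (2n+2)b + 1`. -/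
theorem rowRegion_collar_mem_box (b n : ℕ) :
    ∀ e ∈ rowRegion b n ∪ (plaquettesTouching (rowRegion b n)).biUnion plaquetteEdges,
      e.1 ∈ box 4 ((2 * n + 2) * b + 1) := by
  intro e he
  have hb : (0 : ℤ) ≤ b := Int.natCast_nonneg b
  have hn : (0 : ℤ) ≤ n := Int.natCast_nonneg n
  rw [mem_box]
  intro k
  push_cast
  rcases Finset.mem_union.1 he with he | he
  · have h := (coords_of_mem_rowRegion he).2 k
    have : (if k = 0 then (1 : ℤ) else 0) ≤ 1 := by split_ifs <;> norm_num
    constructor <;> nlinarith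
  · obtain ⟨e', he', hn'⟩ := exists_near_of_mem_collar he
    have h := (coords_of_mem_rowRegion he').2 k
    have hk := hn' k
    have : (if k = 0 then (1 : ℤ) else 0) ≤ 1 := by split_ifs <;> norm_num
    constructor <;> nlinarith

omit [TopologicalSpace G] [IsTopologicalGroup G] [CompactSpace G] [SecondCountableTopology G]
  [MeasurableSpace G] [BorelSpace G] in
/-- **PROVED.** The loop is based in `box 4 S`. -/
theorem loopEdges_mem_box {b n m : ℕ} (hm : (m : ℤ) = (2 * (n : ℤ) + 1) * b) :
    ∀ e ∈ loopEdges b m, e.1 ∈ box 4 ((2 * n + 2) * b + 1) := by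
  intro e he
  have hb : (0 : ℤ) ≤ b := Int.natCast_nonneg b
  have hn : (0 : ℤ) ≤ n := Int.natCast_nonneg n
  have hnb : (0 : ℤ) ≤ (n : ℤ) * b := mul_nonneg hn hb
  -- every loop site is `site2 t s` with `0 ≤ t ≤ b + 1`, `0 ≤ s ≤ m`
  have key : ∀ t s : ℤ, 0 ≤ t → t ≤ (b : ℤ) + 1 → 0 ≤ s → s ≤ (m : ℤ) →
      site2 t s ∈ box 4 ((2 * n + 2) * b + 1) := by
    intro t s ht0 ht1 hs0 hs1
    rw [mem_box]
    intro k
    push_cast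
    simp only [site2]
    split_ifs <;> constructor <;> nlinarith
  have hm0 : (0 : ℤ) ≤ (m : ℤ) := Int.natCast_nonneg m
  simp only [loopEdges, colEdges, stapleEdges, Finset.mem_union, Finset.mem_image, Finset.mem_range,
    Finset.mem_singleton] at he
  rcases he with (rfl | ⟨i, hi, rfl⟩) | (((⟨s, hs, rfl⟩ | ⟨t, ht, rfl⟩) | ⟨s, hs, rfl⟩) | rfl)
  · exact key 1 0 (by norm_num) (by linarith) le_rfl hm0
  · have hi' : (i : ℤ) + 2 ≤ (b : ℤ) := by omega
    exact key _ 0 (by positivity) (by linarith) le_rfl hm0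
  · have hs' : (s : ℤ) < (m : ℤ) := by exact_mod_cast hs
    exact key _ _ (by positivity) le_rfl (Int.natCast_nonneg s) hs'.le
  · have ht' : (t : ℤ) < (b : ℤ) + 1 := by exact_mod_cast ht
    exact key _ _ (Int.natCast_nonneg t) ht'.le hm0 le_rfl
  · have hs' : (s : ℤ) < (m : ℤ) := by exact_mod_cast hs
    exact key 0 _ le_rfl (by linarith) (Int.natCast_nonneg s) hs'.le
  · exact key 0 0 le_rfl (by linarith) le_rfl hm0

/-! ### 4d. Properness and the torus DLR equation (PROVED) -/

/-- **PROVED (properness).** Under the row kernel with datum `ζ` the loop IS the data-adapted charged test of `ζ`: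
`∫ W dγ_row(ζ) = ∫ Re g_ζ dγ_row(ζ)` (the staple is glued to `ζ`; tree `integral_ymSpecification`, `glueWith`). -/
theorem integral_loopObs_eq (hρ : Continuous ρ) (β : ℝ) {b n m : ℕ} (hm : (m : ℤ) = (2 * (n : ℤ) + 1) * b)
    (ζ : LGConfig 4 G) :
    ∫ U, loopObs ρ b m U ∂(ymSpecification ρ β (rowRegion b n) ζ) =
      ∫ U, (chargedTest ρ b m ζ U).re ∂(ymSpecification ρ β (rowRegion b n) ζ) := by
  rw [integral_ymSpecification ρ hρ β _ (continuous_loopObs ρ hρ b m).measurable,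
    integral_ymSpecification ρ hρ β _ (F := fun U => (chargedTest ρ b m ζ U).re)
      (Complex.measurable_re.comp (measurable_chargedTest ρ hρ b m ζ))]
  congr 1
  refine integral_congr_ae (ae_of_all _ fun ζ' => ?_)
  have hst : staple b m (glueWith (rowRegion b n) ζ' ζ) = staple b m ζ :=
    staple_eq_of_eq_off_row hm fun e he => glueWith_apply_not_mem _ _ _ he
  simp only [loopObs, chargedTest, hst]

/-- **PROVED (torus DLR, instance of the tree's `integral_torusLift_eq_integral_ymSpecification`).** -/
theorem integral_loopObs_torus (hρ : Continuous ρ) (hρu : ∀ g, ρ g ∈ Matrix.unitaryGroup (Fin N) ℂ)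
    (β : ℝ) {b n m : ℕ} (hm : (m : ℤ) = (2 * (n : ℤ) + 1) * b) :
    ∫ V, loopObs ρ b m (torusLift (2 * ((2 * n + 2) * b + 1) + 1) V)
        ∂(wilsonMeasure (d := 4) (L := 2 * ((2 * n + 2) * b + 1) + 1) ρ β) =
      ∫ V, (∫ U, loopObs ρ b m U ∂(ymSpecification ρ β (rowRegion b n)
          (torusLift (2 * ((2 * n + 2) * b + 1) + 1) V)))
        ∂(wilsonMeasure (d := 4) (L := 2 * ((2 * n + 2) * b + 1) + 1) ρ β) :=
  integral_torusLift_eq_integral_ymSpecification ρ hρ β (rowRegion b n) (continuous_loopObs ρ hρ b m)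
    (abs_loopObs_le ρ hρu b m) (loopObs_isCylinder ρ b m) (rowRegion_collar_mem_box b n)
    (loopEdges_mem_box hm)

/-! ### 4e. The pointwise bound at a twisted typical pair (PROVED, from §3) -/

/-- **PROVED.** If `Typ` satisfies clause (i_T) at the standard frame and the datum `ζ` is typical TOGETHER WITH its
twist `τ_1 ζ` on the window+shell cells off the row, then the row kernel's mean of the LOOP is `≤ 4ε/‖1−c‖`. -/
theorem integral_loopObs_le_of_clauseI (hρ : Continuous ρ) (hρu : ∀ g, ρ g ∈ Matrix.unitaryGroup (Fin N) ℂ)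
    {β : ℝ} {b n m : ℕ} (hb : 1 ≤ b) (hm : (m : ℤ) = (2 * (n : ℤ) + 1) * b) {ε : ℝ}
    {Typ : (Fin 4 → ℤ) → Set (LGConfig 4 G)} (hI : ClauseI ρ β (stdFrame b) n ε Typ)
    {g₀ : G} (hg : g₀ ∈ Subgroup.center G) {c : ℂ} (hρc : ρ g₀ = c • (1 : Matrix (Fin N) (Fin N) ℂ))
    (hc : c ≠ 1) (ζ : LGConfig 4 G)
    (hζ : ∀ c' ∈ windowCellsPlus n, c' ∉ rowCells n → ζ ∈ Typ c' ∧ layerTwist 1 g₀ ζ ∈ Typ c') :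
    ∫ U, loopObs ρ b m U ∂(ymSpecification ρ β (rowRegion b n) ζ) ≤ 4 * ε / ‖1 - c‖ := by
  rw [integral_loopObs_eq ρ hρ β hm ζ]
  haveI : IsProbabilityMeasure (ymSpecification ρ β (rowRegion b n) ζ) :=
    isProbabilityMeasure_ymSpecification ρ hρ β _ ζ
  have hgi : Integrable (chargedTest ρ b m ζ) (ymSpecification ρ β (rowRegion b n) ζ) :=
    (integrable_const (1 : ℝ)).mono' (measurable_chargedTest ρ hρ b m ζ).aestronglyMeasurable
      (ae_of_all _ fun U => norm_chargedTest_le ρ hρu b m ζ U)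
  have hre : ∫ U, (chargedTest ρ b m ζ U).re ∂(ymSpecification ρ β (rowRegion b n) ζ) =
      (∫ U, chargedTest ρ b m ζ U ∂(ymSpecification ρ β (rowRegion b n) ζ)).re := by
    simpa using Complex.reCLM.integral_comp_comm hgi
  rw [hre]
  have hk : (1 : ℤ) ≤ 1 ∧ (1 : ℤ) ≤ (b : ℤ) := ⟨le_rfl, by exact_mod_cast hb⟩
  exact (Complex.re_le_norm _).trans
    (norm_integral_charged_le_of_clauseI ρ hρ hI hg hk hc (measurable_chargedTest ρ hρ b m ζ)
      (norm_chargedTest_le ρ hρu b m ζ) (chargedTest_isCylinder ρ hb m ζ)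
      (chargedTest_layerTwist ρ hρc b m ζ) ζ hζ)

/-! ### 4f. The two named inputs S1, S2 (both PROVED; stub names kept for the card's references) -/

/-- **STUB S1 — twisted typical pairs are abundant (union bound + torus gauge invariance; M).**
For a measurable CELL-LOCAL class `Typ` whose single-cell atypicality has torus probability `≤ δ` on every cell of
window+shell (the format's anchor (iii_T) at `F = {c}`), the data `V` for which BOTH `torusLift V` and its twist
`τ_1 (torusLift V)` are typical on all window+shell cells off the row have mass `≥ 1 − 2·#cells·δ`.
Proof sketch: the first kind of failure has mass `≤ δ` per cell by hypothesis; for the second,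
`τ_1 = gaugeTransformZd (slabGauge 1 g₀)` (§0) agrees on every edge with an endpoint in `box 4 S` with
`gaugeTransformZd (ĝ ∘ Torus.proj)`, `ĝ := slabGauge 1 g₀ ∘ Torus.cRep` (tree `Torus.cRep_proj_of_mem_box`), and
`torusLift (gaugeTransform ĝ V) = gaugeTransformZd (ĝ ∘ proj) (torusLift V)` (tree
`WilsonBlockHeatBath.torusLift_gaugeTransform`); the cells of window+shell are based in `box 4 ((2n+2)b)` so by
cell-locality (`hdep`) `{τ_1 lift V ∉ Typ c} = (gaugeTransform ĝ)⁻¹ {lift V ∉ Typ c}`, of the same mass by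
`wilsonMeasure_map_gaugeTransform_holds`; finish with the union bound over `windowCellsPlus n`. -/
theorem cellEdges_endpoints_mem_box {b n S : ℕ} (hS : (2 * n + 2) * b + 1 ≤ S) {c : Fin 4 → ℤ}
    (hc : c ∈ windowCellsPlus n) {e : ZdEdge 4} (he : e ∈ cellEdges (stdFrame b) c) :
    e.1 ∈ box 4 S ∧ e.1 + Pi.single e.2 1 ∈ box 4 S := by
  have hci : ∀ i, -(2 * (n : ℤ) + 1) ≤ c i ∧ c i ≤ 2 * (n : ℤ) + 1 := fun i => by
    have := Fintype.mem_piFinset.1 hc i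
    simpa [Finset.mem_Icc] using this
  have hei : ∀ i, stdFrame b i (c i) ≤ e.1 i ∧ e.1 i < stdFrame b i (c i + 1) := fun i =>
    Finset.mem_Ico.1 (Fintype.mem_piFinset.1 (Finset.mem_product.1 he).1 i)
  have hb : (0 : ℤ) ≤ b := Int.natCast_nonneg b
  have hS' : (2 * (n : ℤ) + 2) * b + 1 ≤ (S : ℤ) := by exact_mod_cast hS
  have hcoord : ∀ i, -(S : ℤ) ≤ e.1 i ∧ e.1 i + 1 ≤ (S : ℤ) := by
    intro i
    have h := hei i
    have h1 := mul_le_mul_of_nonneg_left (hci i).1 hb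
    have h2 := mul_le_mul_of_nonneg_left (hci i).2 hb
    by_cases hi : i = 0
    · subst hi
      simp only [stdFrame, if_true] at h
      constructor <;> nlinarith
    · simp only [stdFrame, if_neg hi] at h
      constructor <;> nlinarith
  rw [mem_box, mem_box]
  refine ⟨fun i => ⟨(hcoord i).1, by linarith [(hcoord i).2]⟩, fun i => ?_⟩
  rw [Pi.add_apply, Pi.single_apply]
  split_ifs <;> constructor <;> linarith [(hcoord i).1, (hcoord i).2]

omit [SecondCountableTopology G] in
/-- **S1 — twisted typical pairs are abundant (PROVED; union bound + torus gauge invariance).**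
For a measurable CELL-LOCAL class `Typ` whose single-cell atypicality has torus probability `≤ δ` on every cell of
window+shell (the format's anchor (iii_T) at `F = {c}`), the data `V` for which BOTH `torusLift V` and its twist
`τ_1 (torusLift V)` are typical on all window+shell cells have mass `≥ 1 − 2·#cells·δ`.
Proof: the first kind of failure has mass `≤ δ` per cell by hypothesis; for the second,
`τ_1 = gaugeTransformZd (slabGauge 1 g₀)` (§0) agrees on every edge with both endpoints in `box 4 S` with
`gaugeTransformZd (ĝ ∘ Torus.proj)`, `ĝ := slabGauge 1 g₀ ∘ Torus.cRep` (tree `Torus.cRep_proj_of_mem_box`), and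
`torusLift (gaugeTransform ĝ V) = gaugeTransformZd (ĝ ∘ proj) (torusLift V)` (tree
`WilsonBlockHeatBath.torusLift_gaugeTransform`); the cells of window+shell are based in `box 4 S` so by
cell-locality (`hdep`) `{τ_1 lift V ∉ Typ c} = (gaugeTransform ĝ)⁻¹ {lift V ∉ Typ c}`, of the same mass by
`wilsonMeasure_map_gaugeTransform_holds`; finish with the union bound over `windowCellsPlus n`. -/
theorem twistedTypicalPairs (β : ℝ) {b n S : ℕ}
    (hS : (2 * n + 2) * b + 1 ≤ S) (Typ : (Fin 4 → ℤ) → Set (LGConfig 4 G))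
    (hmeas : ∀ c, MeasurableSet (Typ c))
    (hdep : ∀ c, DependsOn (fun σ : LGConfig 4 G => σ ∈ Typ c) ↑(cellEdges (stdFrame b) c)) {δ : ℝ}
    (hδ : 0 ≤ δ)
    (hanch : ∀ c ∈ windowCellsPlus n,
      (wilsonMeasure (d := 4) (L := 2 * S + 1) ρ β)
          {V : GaugeConfig 4 (2 * S + 1) G | torusLift (2 * S + 1) V ∉ Typ c} ≤ ENNReal.ofReal δ)
    {g₀ : G} (hg : g₀ ∈ Subgroup.center G) :
    ∃ B : Set (GaugeConfig 4 (2 * S + 1) G), MeasurableSet B ∧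
      (wilsonMeasure (d := 4) (L := 2 * S + 1) ρ β) B ≤
        ENNReal.ofReal (2 * ((windowCellsPlus n).card : ℝ) * δ) ∧
      ∀ V ∉ B, ∀ c ∈ windowCellsPlus n, c ∉ rowCells n →
        torusLift (2 * S + 1) V ∈ Typ c ∧ layerTwist 1 g₀ (torusLift (2 * S + 1) V) ∈ Typ c := by
  classical
  set L : ℕ := 2 * S + 1 with hL
  set μ := wilsonMeasure (d := 4) (L := L) ρ β with hμ
  -- the two kinds of bad events
  set A : (Fin 4 → ℤ) → Set (GaugeConfig 4 L G) := fun c => {V | torusLift L V ∉ Typ c} with hA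
  set T : (Fin 4 → ℤ) → Set (GaugeConfig 4 L G) :=
    fun c => {V | layerTwist 1 g₀ (torusLift L V) ∉ Typ c} with hT
  have hAm : ∀ c, MeasurableSet (A c) := fun c =>
    (hmeas c).compl.preimage (measurable_torusLift L)
  have hTm : ∀ c, MeasurableSet (T c) := fun c =>
    (hmeas c).compl.preimage ((measurable_layerTwist 1 g₀).comp (measurable_torusLift L))
  have hanchA : ∀ c ∈ windowCellsPlus n, μ (A c) ≤ ENNReal.ofReal δ := hanch
  -- the torus gauge `ĝ = slabGauge 1 g₀ ∘ cRep` implements `τ_1` on every window+shell cell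
  have hkey : ∀ c ∈ windowCellsPlus n,
      T c = gaugeTransform (fun x => slabGauge 1 g₀ (Torus.cRep x)) ⁻¹' A c := by
    intro c hc
    ext V
    simp only [hT, hA, Set.mem_setOf_eq, Set.mem_preimage, not_iff_not]
    have hagree : ∀ e ∈ (↑(cellEdges (stdFrame b) c) : Set (ZdEdge 4)),
        layerTwist 1 g₀ (torusLift L V) e =
          torusLift L (gaugeTransform (fun x => slabGauge 1 g₀ (Torus.cRep x)) V) e := by
      intro e he
      have hbox := cellEdges_endpoints_mem_box hS hc (Finset.mem_coe.1 he)
      rw [layerTwist_eq_gaugeTransformZd hg, WilsonBlockHeatBath.torusLift_gaugeTransform]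
      simp only [gaugeTransformZd, Function.comp_apply]
      rw [Torus.cRep_proj_of_mem_box (by omega) hbox.1, Torus.cRep_proj_of_mem_box (by omega) hbox.2]
    exact Iff.of_eq (hdep c hagree)
  have hμT : ∀ c ∈ windowCellsPlus n, μ (T c) ≤ ENNReal.ofReal δ := by
    intro c hc
    have hmap : μ.map (gaugeTransform (fun x => slabGauge 1 g₀ (Torus.cRep x))) = μ :=
      wilsonMeasure_map_gaugeTransform_holds (d := 4) (L := L) ρ β _
    rw [hkey c hc, ← Measure.map_apply (WilsonBlockHeatBath.measurable_gaugeTransform _) (hAm c), hmap]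
    exact hanchA c hc
  -- the bad set: union bound
  refine ⟨⋃ c ∈ windowCellsPlus n, (A c ∪ T c), ?_, ?_, ?_⟩
  · exact Finset.measurableSet_biUnion _ fun c _ => (hAm c).union (hTm c)
  · calc μ (⋃ c ∈ windowCellsPlus n, (A c ∪ T c))
          ≤ ∑ c ∈ windowCellsPlus n, μ (A c ∪ T c) := measure_biUnion_finset_le _ _
      _ ≤ ∑ c ∈ windowCellsPlus n, (ENNReal.ofReal δ + ENNReal.ofReal δ) :=
          Finset.sum_le_sum fun c hc =>
            (measure_union_le _ _).trans (add_le_add (hanchA c hc) (hμT c hc))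
      _ = ENNReal.ofReal (2 * ((windowCellsPlus n).card : ℝ) * δ) := by
          rw [Finset.sum_const, nsmul_eq_mul, ← ENNReal.ofReal_add hδ hδ, ← ENNReal.ofReal_natCast,
            ← ENNReal.ofReal_mul (Nat.cast_nonneg _)]
          congr 1
          ring
  · intro V hV c hc _
    simp only [Set.mem_iUnion, Set.mem_union, not_exists, not_or] at hV
    have h := hV c hc
    refine ⟨of_not_not fun h1 => h.1 ?_, of_not_not fun h2 => h.2 ?_⟩
    · exact h1
    · exact h2


end FixedMesh

end Summit.QuantumFields.YangMills.Cruxes.IR.FixedMesh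

end
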